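import Summits.NavierStokesRegularity.NavierStokesRegularity.Theorems.PerpetualPumpAveragedTypeIBlowupIncubationApriori

/-!
# Crux `PerpetualPump.AveragedTypeIBlowup` (stmt-NavierStokesRegularity-1835), line `Sketch`:
# stub `incubation` — memory majorants and the carrier deviation before ignition

Second part of the bootstrap behind the registered stub `stub_incubation` (phase I of the window
one-step theorem for the seeded Toda front pair
`b' = -b - w² + wl² - ε̄ b w + e₀`, `w' = w γ + ε̄ b² + e₁`, memory errors `|eᵢ| ≤ η mᵢ` with
Duhamel majorants `mᵢ`).

`incubation_majorants`: given the a priori bond bounds of `incubation_apriori` on an initial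
segment `[0, σ]` of the pre-ignition horizon, the bond majorant is slaved to the bond,
`m₁ ≤ μ₁ + (5/4) w + ε̄ (B+3)² u`; the carrier majorant error is small, `η m₀ ≤ 13/100`; the
carrier deviates from free decay by `-(19/25) θ₀² - (13/100) u ≤ b - B e^{-u} ≤ Φ₁ + (13/100) u`
(`incubation_deviation` with `p = w² + ε̄ b w + η m₀`, `q = wl² + η m₀`), and
`B - b(u) - (19/25) θ₀² - (13/100) u ≤ ∫₀ᵘ b ≤ B - b(u) + Φ₁ + (13/100) u` (fundamental theorem
of calculus for `b`). `stub_incubationMajorants` is its registered closed form.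

## References

T. Tao, *Finite time blowup for an averaged three-dimensional Navier–Stokes equation*, J. Amer.
Math. Soc. 29 (2016), §5–6; folklore ODE bookkeeping.
-/

noncomputable section

-- the summit namespace `…NavierStokesRegularity.NavierStokesRegularity…` is the tree convention
set_option linter.dupNamespace false

open MeasureTheory Set Filter Topology

namespace Summit.NavierStokesRegularity.NavierStokesRegularity.Theorems.PerpetualPumpAveragedTypeIBlowup

/-- **Memory majorants and carrier deviation before ignition.** On an initial segment `[0, σ]`
of the pre-ignition horizon carrying the a priori bond bounds (`b ∈ [37/2, B + 5/2]`, `w ≥ 0`,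
`∫₀ᵘ (w² + ε̄ b w) ≤ (19/25) θ₀²`, `∫₀ᵘ b w ≤ (9/8) w(u)`): the bond majorant is slaved to the
bond, the carrier majorant error is `≤ 13/100`, the carrier stays within
`[B e^{-u} - (19/25) θ₀² - (13/100) u, B e^{-u} + Φ₁ + (13/100) u]`, and
`B - b(u) - (19/25) θ₀² - (13/100) u ≤ ∫₀ᵘ b ≤ B - b(u) + Φ₁ + (13/100) u`. [folklore] -/
theorem incubation_majorants {b w γ wl m0 m1 e0 : ℝ → ℝ} {B εb θ₀ θ η μ₀ μ₁ Φ₁ T σ : ℝ}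
    (hεb : 0 < εb) (hθ₀ : 0 < θ₀) (hθ₀' : θ₀ ≤ 1) (hθ : 1 / 2 ≤ θ) (hη : 0 ≤ η)
    (hη' : η ≤ 1 / 100) (hημ₀ : η * μ₀ ≤ 1 / 10) (hΦ₁' : Φ₁ ≤ 2)
    (hb : ContinuousOn b (Icc 0 T)) (hw : ContinuousOn w (Icc 0 T))
    (hγ : ContinuousOn γ (Icc 0 T)) (hwl : ContinuousOn wl (Icc 0 T))
    (hm0 : ContinuousOn m0 (Icc 0 T)) (he0 : ContinuousOn e0 (Icc 0 T))
    (hdb : ∀ s ∈ Ioo 0 T,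
      HasDerivAt b (-(b s) - (w s) ^ 2 + (wl s) ^ 2 - εb * b s * w s + e0 s) s)
    (hγb : ∀ s ∈ Icc 0 T, b s - 2 ≤ γ s ∧ γ s ≤ b s)
    (he0m : ∀ s ∈ Icc 0 T, |e0 s| ≤ η * m0 s)
    (hm0D : ∀ s ∈ Icc 0 T, 0 ≤ m0 s ∧ m0 s ≤ m0 0 * Real.exp (-(θ * s)) +
      ∫ r in (0 : ℝ)..s, Real.exp (-(θ * (s - r))) * |-(w r) ^ 2 + (wl r) ^ 2 - εb * b r * w r|)
    (hm1D : ∀ s ∈ Icc 0 T, 0 ≤ m1 s ∧ m1 s ≤ m1 0 * Real.exp (-(θ * s)) +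
      ∫ r in (0 : ℝ)..s, Real.exp (-(θ * (s - r))) * |w r * (γ r + 1) + εb * (b r) ^ 2|)
    (hwlΦ : ∀ s ∈ Icc 0 T, ∫ r in (0 : ℝ)..s, (wl r) ^ 2 ≤ Φ₁)
    (hb0 : b 0 = B) (hm00 : m0 0 ≤ μ₀) (hm10 : m1 0 ≤ μ₁) (hσ : σ ∈ Icc 0 T)
    (ha : ∀ u ∈ Icc 0 σ, 37 / 2 ≤ b u ∧ b u ≤ B + 5 / 2) (hnn : ∀ u ∈ Icc 0 σ, 0 ≤ w u)
    (hJ : ∀ u ∈ Icc 0 σ, ∫ s in (0 : ℝ)..u, ((w s) ^ 2 + εb * b s * w s) ≤ 19 / 25 * θ₀ ^ 2)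
    (hbw : ∀ u ∈ Icc 0 σ, ∫ s in (0 : ℝ)..u, b s * w s ≤ 9 / 8 * w u) :
    (∀ u ∈ Icc 0 σ, m1 u ≤ μ₁ + 5 / 4 * w u + εb * (B + 3) ^ 2 * u) ∧
    (∀ u ∈ Icc 0 σ, η * m0 u ≤ 13 / 100) ∧
    (∀ u ∈ Icc 0 σ, B * Real.exp (-u) - (19 / 25 * θ₀ ^ 2 + 13 / 100 * u) ≤ b u ∧
      b u ≤ B * Real.exp (-u) + Φ₁ + 13 / 100 * u) ∧
    (∀ u ∈ Icc 0 σ, B - b u - 19 / 25 * θ₀ ^ 2 - 13 / 100 * u ≤ ∫ s in (0 : ℝ)..u, b s ∧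
      ∫ s in (0 : ℝ)..u, b s ≤ B - b u + Φ₁ + 13 / 100 * u) := by
  have hσT : Icc 0 σ ⊆ Icc 0 T := Icc_subset_Icc_right hσ.2
  have hT0 : 0 ≤ T := hσ.1.trans hσ.2
  have hθ0 : 0 ≤ θ := by linarith
  have hθ₀1 : θ₀ ^ 2 ≤ 1 := by nlinarith
  have hΦ₁0 : 0 ≤ Φ₁ := by
    have h := hwlΦ 0 ⟨le_rfl, hT0⟩
    rwa [intervalIntegral.integral_same] at h
  -- (h) the bond majorant is slaved to the bond
  have hM1 : ∀ u ∈ Icc 0 σ, m1 u ≤ μ₁ + 5 / 4 * w u + εb * (B + 3) ^ 2 * u := by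
    intro u hu
    have huT : Icc 0 u ⊆ Icc 0 T := Icc_subset_Icc_right (hu.2.trans hσ.2)
    obtain ⟨-, hle⟩ := hm1D u (hσT hu)
    have h00 : 0 ≤ m1 0 := (hm1D 0 ⟨le_rfl, hT0⟩).1
    have hex : Real.exp (-(θ * u)) ≤ 1 :=
      Real.exp_le_one_iff.2 (by nlinarith [hu.1])
    have h1 : m1 0 * Real.exp (-(θ * u)) ≤ μ₁ :=
      (mul_le_of_le_one_right h00 hex).trans hm10
    have hFc : ContinuousOn
        (fun r => Real.exp (-(θ * (u - r))) * |w r * (γ r + 1) + εb * (b r) ^ 2|) (Icc 0 u) :=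
      ((continuousOn_const.mul (continuousOn_const.sub continuousOn_id)).neg.rexp).mul
        (((hw.mono huT).mul ((hγ.mono huT).add continuousOn_const)).add
          (continuousOn_const.mul ((hb.mono huT).pow 2))).norm
    have hGc : ContinuousOn (fun r => 39 / 37 * (b r * w r) + εb * (B + 3) ^ 2) (Icc 0 u) :=
      (continuousOn_const.mul ((hb.mono huT).mul (hw.mono huT))).add continuousOn_const
    have h2 := incubation_integral_mono hu.1 hFc hGc fun r hr => ?_
    · have h3 : ∫ r in (0 : ℝ)..u, (39 / 37 * (b r * w r) + εb * (B + 3) ^ 2) =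
          39 / 37 * (∫ r in (0 : ℝ)..u, b r * w r) + εb * (B + 3) ^ 2 * u := by
        rw [intervalIntegral.integral_add, intervalIntegral.integral_const_mul,
          intervalIntegral.integral_const, smul_eq_mul]
        · ring
        · exact ((continuousOn_const.mul ((hb.mono huT).mul
            (hw.mono huT))).intervalIntegrable_of_Icc hu.1)
        · exact continuousOn_const.intervalIntegrable_of_Icc hu.1
      rw [h3] at h2
      have h4 := hbw u hu
      have h5 := hnn u hu
      linarith
    · have hrσ : r ∈ Icc 0 σ := ⟨hr.1, hr.2.trans hu.2⟩
      obtain ⟨hbl, hbu⟩ := ha r hrσ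
      have hwr := hnn r hrσ
      obtain ⟨hγ1, hγ2⟩ := hγb r (hσT hrσ)
      have hex' : Real.exp (-(θ * (u - r))) ≤ 1 :=
        Real.exp_le_one_iff.2 (by nlinarith [hr.2])
      have hin : 0 ≤ w r * (γ r + 1) + εb * (b r) ^ 2 := by
        have : 0 ≤ w r * (γ r + 1) := mul_nonneg hwr (by linarith)
        positivity
      have hb2 : (b r) ^ 2 ≤ (B + 3) ^ 2 := pow_le_pow_left₀ (by linarith) (by linarith) 2
      have hwb : w r * (γ r + 1) ≤ 39 / 37 * (b r * w r) := by
        have : w r * (γ r + 1) ≤ w r * (39 / 37 * b r) :=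
          mul_le_mul_of_nonneg_left (by linarith) hwr
        linarith
      calc Real.exp (-(θ * (u - r))) * |w r * (γ r + 1) + εb * (b r) ^ 2|
          ≤ 1 * |w r * (γ r + 1) + εb * (b r) ^ 2| :=
            mul_le_mul_of_nonneg_right hex' (abs_nonneg _)
        _ ≤ 39 / 37 * (b r * w r) + εb * (B + 3) ^ 2 := by
            rw [one_mul, abs_of_nonneg hin]
            nlinarith
  -- (i) the carrier majorant error is small
  have hM0 : ∀ u ∈ Icc 0 σ, η * m0 u ≤ 13 / 100 := by
    intro u hu
    have huT : Icc 0 u ⊆ Icc 0 T := Icc_subset_Icc_right (hu.2.trans hσ.2)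
    obtain ⟨-, hle⟩ := hm0D u (hσT hu)
    have h00 : 0 ≤ m0 0 := (hm0D 0 ⟨le_rfl, hT0⟩).1
    have hex : Real.exp (-(θ * u)) ≤ 1 :=
      Real.exp_le_one_iff.2 (by nlinarith [hu.1])
    have h1 : m0 0 * Real.exp (-(θ * u)) ≤ μ₀ := (mul_le_of_le_one_right h00 hex).trans hm00
    have hFc : ContinuousOn (fun r => Real.exp (-(θ * (u - r))) *
        |-(w r) ^ 2 + (wl r) ^ 2 - εb * b r * w r|) (Icc 0 u) :=
      ((continuousOn_const.mul (continuousOn_const.sub continuousOn_id)).neg.rexp).mul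
        ((((hw.mono huT).pow 2).neg.add ((hwl.mono huT).pow 2)).sub
          ((continuousOn_const.mul (hb.mono huT)).mul (hw.mono huT))).norm
    have hGc : ContinuousOn (fun r => ((w r) ^ 2 + εb * b r * w r) + (wl r) ^ 2) (Icc 0 u) :=
      (((hw.mono huT).pow 2).add ((continuousOn_const.mul (hb.mono huT)).mul
        (hw.mono huT))).add ((hwl.mono huT).pow 2)
    have h2 := incubation_integral_mono hu.1 hFc hGc fun r hr => ?_
    · have hi1 : IntervalIntegrable (fun r => (w r) ^ 2 + εb * b r * w r) volume 0 u :=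
        (((hw.mono huT).pow 2).add ((continuousOn_const.mul (hb.mono huT)).mul
          (hw.mono huT))).intervalIntegrable_of_Icc hu.1
      have hi2 : IntervalIntegrable (fun r => (wl r) ^ 2) volume 0 u :=
        ((hwl.mono huT).pow 2).intervalIntegrable_of_Icc hu.1
      rw [intervalIntegral.integral_add hi1 hi2] at h2
      have h3 := hJ u hu
      have h4 := hwlΦ u (hσT hu)
      have h5 : m0 u ≤ μ₀ + (19 / 25 * θ₀ ^ 2 + Φ₁) := by linarith
      have h6 := mul_le_mul_of_nonneg_left h5 hη
      have h7 : η * (19 / 25 * θ₀ ^ 2 + Φ₁) ≤ 1 / 100 * (19 / 25 * 1 + 2) :=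
        mul_le_mul hη' (by linarith) (by positivity) (by norm_num)
      linarith [mul_add η μ₀ (19 / 25 * θ₀ ^ 2 + Φ₁)]
    · have hrσ : r ∈ Icc 0 σ := ⟨hr.1, hr.2.trans hu.2⟩
      obtain ⟨hbl, -⟩ := ha r hrσ
      have hwr := hnn r hrσ
      have hex' : Real.exp (-(θ * (u - r))) ≤ 1 :=
        Real.exp_le_one_iff.2 (by nlinarith [hr.2])
      have hp1 : 0 ≤ εb * b r * w r := by
        have : 0 ≤ b r := by linarith
        positivity
      have habs : |-(w r) ^ 2 + (wl r) ^ 2 - εb * b r * w r| ≤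
          ((w r) ^ 2 + εb * b r * w r) + (wl r) ^ 2 := by
        rw [abs_le]
        constructor <;> nlinarith [sq_nonneg (w r), sq_nonneg (wl r)]
      calc Real.exp (-(θ * (u - r))) * |-(w r) ^ 2 + (wl r) ^ 2 - εb * b r * w r|
          ≤ 1 * |-(w r) ^ 2 + (wl r) ^ 2 - εb * b r * w r| :=
            mul_le_mul_of_nonneg_right hex' (abs_nonneg _)
        _ ≤ ((w r) ^ 2 + εb * b r * w r) + (wl r) ^ 2 := by rw [one_mul]; exact habs
  -- (k) the carrier deviation from free decay
  have hpc : ContinuousOn (fun t => ((w t) ^ 2 + εb * b t * w t) + η * m0 t) (Icc 0 σ) :=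
    (((hw.mono hσT).pow 2).add ((continuousOn_const.mul (hb.mono hσT)).mul (hw.mono hσT))).add
      (continuousOn_const.mul (hm0.mono hσT))
  have hqc : ContinuousOn (fun t => (wl t) ^ 2 + η * m0 t) (Icc 0 σ) :=
    ((hwl.mono hσT).pow 2).add (continuousOn_const.mul (hm0.mono hσT))
  have hm0nn : ∀ t ∈ Icc 0 σ, 0 ≤ η * m0 t := fun t ht => mul_nonneg hη (hm0D t (hσT ht)).1
  have hbwnn : ∀ t ∈ Icc 0 σ, 0 ≤ εb * b t * w t := by
    intro t ht
    have h1 := hnn t ht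
    have h2 : 0 ≤ b t := by linarith [(ha t ht).1]
    positivity
  have hdev := incubation_deviation (x := fun t => b t - B * Real.exp (-t))
    (p := fun t => ((w t) ^ 2 + εb * b t * w t) + η * m0 t) (q := fun t => (wl t) ^ 2 + η * m0 t)
    (τ := σ) ((hb.mono hσT).sub (continuousOn_const.mul (continuousOn_id.neg.rexp))) hpc hqc
    (fun t ht => by have := hm0nn t ht; have := hbwnn t ht; positivity)
    (fun t ht => by have := hm0nn t ht; positivity)
    (by simp only [neg_zero, Real.exp_zero, mul_one, hb0, sub_self]) ?_
  swap
  · intro t ht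
    have htσ : t ∈ Icc 0 σ := Ioo_subset_Icc_self ht
    refine ⟨_, (hdb t ⟨ht.1, ht.2.trans_le hσ.2⟩).sub
      (((hasDerivAt_neg' t).exp).const_mul B), ?_, ?_⟩
    · have h1 := he0m t (hσT htσ)
      have h2 := neg_abs_le (e0 t)
      have h3 := sq_nonneg (wl t)
      show -(b t - B * Real.exp (-t)) - (((w t) ^ 2 + εb * b t * w t) + η * m0 t) ≤
        -(b t) - (w t) ^ 2 + (wl t) ^ 2 - εb * b t * w t + e0 t - B * (Real.exp (-t) * -1)
      linarith
    · have h1 := he0m t (hσT htσ)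
      have h2 := le_abs_self (e0 t)
      have h3 := sq_nonneg (w t)
      have h4 := hbwnn t htσ
      show -(b t) - (w t) ^ 2 + (wl t) ^ 2 - εb * b t * w t + e0 t - B * (Real.exp (-t) * -1) ≤
        -(b t - B * Real.exp (-t)) + ((wl t) ^ 2 + η * m0 t)
      linarith
  -- the two error integrals
  have hIq : ∀ u ∈ Icc 0 σ, ∫ s in (0 : ℝ)..u, ((wl s) ^ 2 + η * m0 s) ≤ Φ₁ + 13 / 100 * u := by
    intro u hu
    have huσ : Icc 0 u ⊆ Icc 0 σ := Icc_subset_Icc_right hu.2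
    have hi1 : IntervalIntegrable (fun s => (wl s) ^ 2) volume 0 u :=
      ((hwl.mono (huσ.trans hσT)).pow 2).intervalIntegrable_of_Icc hu.1
    have hi2 : IntervalIntegrable (fun s => η * m0 s) volume 0 u :=
      (continuousOn_const.mul (hm0.mono (huσ.trans hσT))).intervalIntegrable_of_Icc hu.1
    rw [intervalIntegral.integral_add hi1 hi2]
    have h1 := hwlΦ u (hσT hu)
    have h2 := incubation_integral_le_const hu.1 (C := 13 / 100) (f := fun s => η * m0 s)
      (continuousOn_const.mul (hm0.mono (huσ.trans hσT))) fun s hs => hM0 s (huσ hs)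
    linarith
  have hIp : ∀ u ∈ Icc 0 σ, ∫ s in (0 : ℝ)..u, (((w s) ^ 2 + εb * b s * w s) + η * m0 s) ≤
      19 / 25 * θ₀ ^ 2 + 13 / 100 * u := by
    intro u hu
    have huσ : Icc 0 u ⊆ Icc 0 σ := Icc_subset_Icc_right hu.2
    have huT : Icc 0 u ⊆ Icc 0 T := huσ.trans hσT
    have hi1 : IntervalIntegrable (fun s => (w s) ^ 2 + εb * b s * w s) volume 0 u :=
      (((hw.mono huT).pow 2).add ((continuousOn_const.mul (hb.mono huT)).mul
        (hw.mono huT))).intervalIntegrable_of_Icc hu.1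
    have hi2 : IntervalIntegrable (fun s => η * m0 s) volume 0 u :=
      (continuousOn_const.mul (hm0.mono huT)).intervalIntegrable_of_Icc hu.1
    rw [intervalIntegral.integral_add hi1 hi2]
    have h1 := hJ u hu
    have h2 := incubation_integral_le_const hu.1 (C := 13 / 100) (f := fun s => η * m0 s)
      (continuousOn_const.mul (hm0.mono huT)) fun s hs => hM0 s (huσ hs)
    linarith
  have hK : ∀ u ∈ Icc 0 σ, B * Real.exp (-u) - (19 / 25 * θ₀ ^ 2 + 13 / 100 * u) ≤ b u ∧
      b u ≤ B * Real.exp (-u) + Φ₁ + 13 / 100 * u := by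
    intro u hu
    obtain ⟨h1, h2⟩ := hdev u hu
    have h3 := hIq u hu
    have h4 := hIp u hu
    constructor <;> linarith
  -- (l) the integral of the carrier
  have hL : ∀ u ∈ Icc 0 σ, B - b u - 19 / 25 * θ₀ ^ 2 - 13 / 100 * u ≤ ∫ s in (0 : ℝ)..u, b s ∧
      ∫ s in (0 : ℝ)..u, b s ≤ B - b u + Φ₁ + 13 / 100 * u := by
    intro u hu
    have huσ : Icc 0 u ⊆ Icc 0 σ := Icc_subset_Icc_right hu.2
    have huT : Icc 0 u ⊆ Icc 0 T := huσ.trans hσT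
    have hDc : ContinuousOn
        (fun s => -(b s) - (w s) ^ 2 + (wl s) ^ 2 - εb * b s * w s + e0 s) (Icc 0 u) :=
      (((((hb.mono huT).neg.sub ((hw.mono huT).pow 2)).add ((hwl.mono huT).pow 2)).sub
        ((continuousOn_const.mul (hb.mono huT)).mul (hw.mono huT))).add (he0.mono huT))
    have hftc := intervalIntegral.integral_eq_sub_of_hasDerivAt_of_le hu.1 (hb.mono huT)
      (fun s hs => hdb s ⟨hs.1, hs.2.trans_le (hu.2.trans hσ.2)⟩)
      (hDc.intervalIntegrable_of_Icc hu.1)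
    rw [hb0] at hftc
    have hiD : IntervalIntegrable
        (fun s => -(b s) - (w s) ^ 2 + (wl s) ^ 2 - εb * b s * w s + e0 s) volume 0 u :=
      hDc.intervalIntegrable_of_Icc hu.1
    have hib : IntervalIntegrable (fun s => b s) volume 0 u :=
      (hb.mono huT).intervalIntegrable_of_Icc hu.1
    have hsum : ∫ s in (0 : ℝ)..u,
        ((-(b s) - (w s) ^ 2 + (wl s) ^ 2 - εb * b s * w s + e0 s) + b s) =
        (b u - B) + ∫ s in (0 : ℝ)..u, b s := by
      rw [intervalIntegral.integral_add hiD hib, hftc]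
    have hDbc : ContinuousOn
        (fun s => (-(b s) - (w s) ^ 2 + (wl s) ^ 2 - εb * b s * w s + e0 s) + b s) (Icc 0 u) :=
      hDc.add (hb.mono huT)
    have hnpc : ContinuousOn (fun s => -(((w s) ^ 2 + εb * b s * w s) + η * m0 s)) (Icc 0 u) :=
      (hpc.mono huσ).neg
    have hup := incubation_integral_mono hu.1 hDbc (hqc.mono huσ)
      (g := fun t => (wl t) ^ 2 + η * m0 t) fun s hs => ?_
    · have hlo := incubation_integral_mono hu.1 hnpc hDbc fun s hs => ?_
      · rw [intervalIntegral.integral_neg] at hlo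
        rw [hsum] at hup hlo
        have h3 := hIq u hu
        have h4 := hIp u hu
        constructor <;> linarith
      · have hsσ := huσ hs
        have h1 := he0m s (hσT hsσ)
        have h2 := neg_abs_le (e0 s)
        have h3 := sq_nonneg (wl s)
        show -(((w s) ^ 2 + εb * b s * w s) + η * m0 s) ≤
          (-(b s) - (w s) ^ 2 + (wl s) ^ 2 - εb * b s * w s + e0 s) + b s
        linarith
    · have hsσ := huσ hs
      have h1 := he0m s (hσT hsσ)
      have h2 := le_abs_self (e0 s)
      have h3 := sq_nonneg (w s)
      have h4 := hbwnn s hsσ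
      show (-(b s) - (w s) ^ 2 + (wl s) ^ 2 - εb * b s * w s + e0 s) + b s ≤
        (wl s) ^ 2 + η * m0 s
      linarith
  exact ⟨hM1, hM0, hK, hL⟩

/-- **Registered sub-goal `stub_incubationMajorants` of the stub `incubation`** (closed form of
`incubation_majorants`). [folklore] -/
theorem stub_incubationMajorants :
    ∀ (b w γ wl m0 m1 e0 : ℝ → ℝ) (B εb θ₀ θ η μ₀ μ₁ Φ₁ T σ : ℝ),
      0 < εb → 0 < θ₀ → θ₀ ≤ 1 → 1 / 2 ≤ θ → 0 ≤ η → η ≤ 1 / 100 → η * μ₀ ≤ 1 / 10 → Φ₁ ≤ 2 →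
      ContinuousOn b (Icc 0 T) → ContinuousOn w (Icc 0 T) → ContinuousOn γ (Icc 0 T) →
      ContinuousOn wl (Icc 0 T) → ContinuousOn m0 (Icc 0 T) → ContinuousOn e0 (Icc 0 T) →
      (∀ s ∈ Ioo 0 T,
        HasDerivAt b (-(b s) - (w s) ^ 2 + (wl s) ^ 2 - εb * b s * w s + e0 s) s) →
      (∀ s ∈ Icc 0 T, b s - 2 ≤ γ s ∧ γ s ≤ b s) → (∀ s ∈ Icc 0 T, |e0 s| ≤ η * m0 s) →
      (∀ s ∈ Icc 0 T, 0 ≤ m0 s ∧ m0 s ≤ m0 0 * Real.exp (-(θ * s)) +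
        ∫ r in (0 : ℝ)..s, Real.exp (-(θ * (s - r))) * |-(w r) ^ 2 + (wl r) ^ 2 - εb * b r * w r|) →
      (∀ s ∈ Icc 0 T, 0 ≤ m1 s ∧ m1 s ≤ m1 0 * Real.exp (-(θ * s)) +
        ∫ r in (0 : ℝ)..s, Real.exp (-(θ * (s - r))) * |w r * (γ r + 1) + εb * (b r) ^ 2|) →
      (∀ s ∈ Icc 0 T, ∫ r in (0 : ℝ)..s, (wl r) ^ 2 ≤ Φ₁) →
      b 0 = B → m0 0 ≤ μ₀ → m1 0 ≤ μ₁ → σ ∈ Icc 0 T →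
      (∀ u ∈ Icc 0 σ, 37 / 2 ≤ b u ∧ b u ≤ B + 5 / 2) → (∀ u ∈ Icc 0 σ, 0 ≤ w u) →
      (∀ u ∈ Icc 0 σ, ∫ s in (0 : ℝ)..u, ((w s) ^ 2 + εb * b s * w s) ≤ 19 / 25 * θ₀ ^ 2) →
      (∀ u ∈ Icc 0 σ, ∫ s in (0 : ℝ)..u, b s * w s ≤ 9 / 8 * w u) →
      (∀ u ∈ Icc 0 σ, m1 u ≤ μ₁ + 5 / 4 * w u + εb * (B + 3) ^ 2 * u) ∧
      (∀ u ∈ Icc 0 σ, η * m0 u ≤ 13 / 100) ∧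
      (∀ u ∈ Icc 0 σ, B * Real.exp (-u) - (19 / 25 * θ₀ ^ 2 + 13 / 100 * u) ≤ b u ∧
        b u ≤ B * Real.exp (-u) + Φ₁ + 13 / 100 * u) ∧
      (∀ u ∈ Icc 0 σ, B - b u - 19 / 25 * θ₀ ^ 2 - 13 / 100 * u ≤ ∫ s in (0 : ℝ)..u, b s ∧
        ∫ s in (0 : ℝ)..u, b s ≤ B - b u + Φ₁ + 13 / 100 * u) :=
  fun _ _ _ _ _ _ _ _ _ _ _ _ _ _ _ _ _ hεb hθ₀ hθ₀' hθ hη hη' hημ₀ hΦ₁' hb hw hγ hwl hm0 he0 hdb hγb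
      he0m hm0D hm1D hwlΦ hb0 hm00 hm10 hσ ha hnn hJ hbw =>
    incubation_majorants hεb hθ₀ hθ₀' hθ hη hη' hημ₀ hΦ₁' hb hw hγ hwl hm0 he0 hdb hγb he0m hm0D
      hm1D hwlΦ hb0 hm00 hm10 hσ ha hnn hJ hbw

end Summit.NavierStokesRegularity.NavierStokesRegularity.Theorems.PerpetualPumpAveragedTypeIBlowup

end
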